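import Summits.CriticalPhenomena.PercolationContinuityZ3.Theorems.PercNearOneGluingNoHeavyPcintBSMXTail
import HarnessLib

/-!
# PCINT lane, PHASE 6 (block renewal with reach-two pieces): the oriented meeting probabilities for two time axes

Cell `prim-pcint`, seat `prim-pcint-1` (gen 15); memo `run/shared/lean/prim/pcint/T-FIBRE-ROUTE.md` §PHASE 6.

For `k = 2` time axes `u 2 i = C(2i,i)/4ⁱ` (`BSMX.u_two_eq`) and `cadj 2 i = u 2 i · i/(i+1)` (**`BSMX.cadj_two_eq`**),
so the coefficient lists `U, C` of a certificate can be checked against the central binomial coefficients, computed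
iteratively in the kernel (`BSMX.cbList`, **`BSMX.cbList_getD`**: `c_{i+1} = c_i · 2(2i+1)/(i+1)`), instead of the
tree's rational table `OSM.vrow` (too heavy for the long horizons of the two-axes instances):
**`BSMX.u_two_dom`**, **`BSMX.cadj_two_dom`** give the real-form hypotheses `u 2 i · DU ≤ U_i`, `cadj 2 i · DU ≤ C_i`
of `BSMX.G0H_le_of_chunks` / `BSMX.G1H_le_of_chunks` from decidable natural-number checks.
-/

noncomputable section

namespace Summit.CriticalPhenomena.PercolationContinuityZ3.Theorems.Pcint.BSMX

open Finset OSM BSM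

/-- The central binomial coefficients `C(2i,i)`, `i = 0..N`, as a list built iteratively (with sharing). -/
def cbList : ℕ → List ℕ
  | 0 => [1]
  | N + 1 =>
    let l := cbList N
    l ++ [l.getD N 0 * (2 * (2 * N + 1)) / (N + 1)]

/-- **The list is the central binomial coefficients.** -/
theorem cbList_getD : ∀ (N i : ℕ), i ≤ N → (cbList N).getD i 0 = Nat.centralBinom i ∧ (cbList N).length = N + 1
  | 0, i, hi => by
    have : i = 0 := by omega
    subst this
    exact ⟨by simp [cbList, Nat.centralBinom_zero], rfl⟩
  | N + 1, i, hi => by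
    have hlen : (cbList N).length = N + 1 := (cbList_getD N 0 (Nat.zero_le _)).2
    refine ⟨?_, by simp [cbList, hlen]⟩
    show (cbList N ++ [(cbList N).getD N 0 * (2 * (2 * N + 1)) / (N + 1)]).getD i 0 = Nat.centralBinom i
    rcases Nat.lt_or_ge i (N + 1) with h | h
    · rw [List.getD_append _ _ _ _ (by rw [hlen]; exact h)]
      exact (cbList_getD N i (by omega)).1
    · have hi' : i = N + 1 := by omega
      subst hi'
      rw [List.getD_append_right _ _ _ _ (by rw [hlen]), hlen, Nat.sub_self, List.getD_cons_zero,
        (cbList_getD N N le_rfl).1]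
      have h := Nat.succ_mul_centralBinom_succ N
      rw [show 2 * (2 * N + 1) * Nat.centralBinom N = Nat.centralBinom N * (2 * (2 * N + 1)) by ring] at h
      rw [← h, Nat.mul_div_cancel_left _ (by omega)]

/-- **`cadj 2 i = u 2 i · i / (i+1)`.** -/
theorem cadj_two_eq (i : ℕ) : cadj 2 i = u 2 i * (i : ℝ) / ((i : ℝ) + 1) := by
  unfold cadj
  have hs := u_two_succ i
  have hi : (0 : ℝ) < (i : ℝ) + 1 := by positivity
  rw [eq_div_iff hi.ne']
  push_cast
  have : u 2 (i + 1) = u 2 i * (2 * (i : ℝ) + 1) / (2 * (i : ℝ) + 2) := by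
    rw [eq_div_iff (by positivity)]; exact hs
  rw [this]
  field_simp
  ring

/-- **The diagonal coefficients from central binomial checks**: `C(2i,i) · DU ≤ U_i · 4ⁱ` gives `u 2 i · DU ≤ U_i`. -/
theorem u_two_dom {N DU : ℕ} {U : List ℕ} (h : ∀ i ∈ List.range N, (cbList N).getD i 0 * DU ≤ U.getD i 0 * 4 ^ i) :
    ∀ i < N, u 2 i * DU ≤ (U.getD i 0 : ℝ) := by
  intro i hi
  have hc := h i (List.mem_range.2 hi)
  rw [(cbList_getD N i hi.le).1] at hc
  have hc' : (Nat.centralBinom i : ℝ) * DU ≤ (U.getD i 0 : ℝ) * 4 ^ i := by exact_mod_cast hc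
  rw [u_two_eq, div_mul_eq_mul_div, div_le_iff₀ (by positivity)]
  exact hc'

/-- **The adjacent coefficients from central binomial checks**: `C(2i,i) · i · DU ≤ C_i · 4ⁱ · (i+1)` gives
`cadj 2 i · DU ≤ C_i`. -/
theorem cadj_two_dom {N DU : ℕ} {C : List ℕ}
    (h : ∀ i ∈ List.range N, (cbList N).getD i 0 * i * DU ≤ C.getD i 0 * 4 ^ i * (i + 1)) :
    ∀ i < N, cadj 2 i * DU ≤ (C.getD i 0 : ℝ) := by
  intro i hi
  have hc := h i (List.mem_range.2 hi)
  rw [(cbList_getD N i hi.le).1] at hc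
  have hc' : (Nat.centralBinom i : ℝ) * i * DU ≤ (C.getD i 0 : ℝ) * 4 ^ i * ((i : ℝ) + 1) := by exact_mod_cast hc
  rw [cadj_two_eq, u_two_eq]
  rw [show (Nat.centralBinom i : ℝ) / 4 ^ i * (i : ℝ) / ((i : ℝ) + 1) * DU =
      ((Nat.centralBinom i : ℝ) * i * DU) / (4 ^ i * ((i : ℝ) + 1)) by field_simp]
  rw [div_le_iff₀ (by positivity)]
  calc (Nat.centralBinom i : ℝ) * i * DU ≤ (C.getD i 0 : ℝ) * 4 ^ i * ((i : ℝ) + 1) := hc'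
    _ = (C.getD i 0 : ℝ) * (4 ^ i * ((i : ℝ) + 1)) := by ring

end Summit.CriticalPhenomena.PercolationContinuityZ3.Theorems.Pcint.BSMX

end
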